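import Mathlib
import HarnessLib
import Summits.NavierStokesRegularity.NavierStokesRegularity.Theorems.TypeIQuarterGateScarEnvelopeTypeIForcedTsaiAlgCertF
import Summits.NavierStokesRegularity.NavierStokesRegularity.Theorems.TypeIQuarterGateScarEnvelopeTypeIForcedTsaiAlgSound

/-!
# ARM B lane E-exact, Type-I-tail class — SOUNDNESS of the v2 rows with a certified polynomial floor:
  `AlgRowF.checkF = true → ForcedTsaiModulusLE M δ`

New ingredients over `…AlgSound`: the Taylor-shift identity `P(w) = Σ_k d_k (w−a)^k` and the piecewise bound
`P ≤ d₀ + Σ_{k≥1} max(d_k,0) h^k` on `[a,a+h]`, the soundness of `FloorCert.check` (`P ≤ 0` on `[0,W₁₀]`, `P ≤ 1` on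
`[W₁₀,1]`), hence `φ = P(W(y)) ≤ 𝟙_{B₁₀}(y)`; the rest is the composition of `…AlgSound` verbatim.
UPPER bounds on the forced-Tsai modulus only; nothing about NS regularity; 23843 / H3 OPEN.
-/

noncomputable section

set_option linter.dupNamespace false

namespace Summit.NavierStokesRegularity.NavierStokesRegularity.Cruxes.ScarEnvelopeTypeI.ForcedTsai

open MeasureTheory Set Metric Real Finset
open scoped RealInnerProductSpace ContDiff
open Literature.Analysis.FluidPDE

namespace FloorCert

/-- Real evaluation of the floor polynomial: `P(w) = Σ_j p_j w^j`. -/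
def evalR (p : List ℚ) (w : ℝ) : ℝ := ∑ j ∈ range p.length, (coeff p j : ℝ) * w ^ j

/-- **Taylor shift**: `P(w) = Σ_k d_k (w − a)^k`. -/
theorem evalR_eq_taylor (p : List ℚ) (a : ℚ) (w : ℝ) :
    evalR p w = ∑ k ∈ range p.length, (taylorCoeff p a k : ℝ) * (w - a) ^ k := by
  unfold evalR taylorCoeff
  simp_rw [Rat.cast_sum, Finset.sum_mul]
  rw [Finset.sum_comm]
  refine Finset.sum_congr rfl fun j hj => ?_
  have hjn : j < p.length := Finset.mem_range.mp hj
  have hsplit : ∀ k ∈ range p.length,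
      (((if k ≤ j then coeff p j * (Nat.choose j k : ℚ) * a ^ (j - k) else 0 : ℚ)) : ℝ) * (w - a) ^ k =
        if k ∈ range (j + 1) then (coeff p j : ℝ) * ((w - a) ^ k * (a : ℝ) ^ (j - k) * (Nat.choose j k : ℝ)) else 0 := by
    intro k _
    by_cases hk : k ≤ j
    · rw [if_pos hk, if_pos (Finset.mem_range.mpr (Nat.lt_succ_of_le hk))]; push_cast; ring
    · rw [if_neg hk, if_neg (by rw [Finset.mem_range]; omega)]; push_cast; ring
  symm
  rw [Finset.sum_congr rfl hsplit, ← Finset.sum_filter, Finset.filter_mem_eq_inter,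
    show range p.length ∩ range (j + 1) = range (j + 1) from
      Finset.inter_eq_right.mpr (Finset.range_subset_range.mpr (by omega)),
    ← Finset.mul_sum, ← add_pow, sub_add_cancel]

/-- **Piecewise bound**: on `[a, a+h]`, `P(w) ≤ upperOn p a h`. -/
theorem evalR_le_upperOn (p : List ℚ) (a h : ℚ) (w : ℝ) (h0 : (a : ℝ) ≤ w) (h1 : w ≤ (a : ℝ) + h) :
    evalR p w ≤ (upperOn p a h : ℝ) := by
  rw [evalR_eq_taylor p a, upperOn]
  push_cast
  refine Finset.sum_le_sum fun k _ => ?_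
  by_cases hk : k = 0
  · subst hk; simp
  · rw [if_neg hk]
    have hwa : 0 ≤ w - a := by linarith
    have hwh : w - a ≤ h := by linarith
    have hpow : (w - a) ^ k ≤ (h : ℝ) ^ k := pow_le_pow_left₀ hwa hwh k
    have hpow0 : 0 ≤ (w - a) ^ k := pow_nonneg hwa k
    have key : (taylorCoeff p a k : ℝ) * (w - a) ^ k ≤ max (taylorCoeff p a k : ℝ) 0 * (h : ℝ) ^ k := by
      rcases le_or_gt 0 (taylorCoeff p a k : ℝ) with hc | hc
      · rw [max_eq_left hc]; exact mul_le_mul_of_nonneg_left hpow hc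
      · rw [max_eq_right hc.le, zero_mul]; exact mul_nonpos_of_nonpos_of_nonneg hc.le hpow0
    have hcast : ((max (taylorCoeff p a k) 0 * h ^ k : ℚ) : ℝ) = max (taylorCoeff p a k : ℝ) 0 * (h : ℝ) ^ k := by
      push_cast; rfl
    rw [hcast]; exact key

/-- `upperOn p a 0` is the exact value `P(a)`. -/
theorem evalR_le_upperOn_zero (p : List ℚ) (a : ℚ) : evalR p a ≤ (upperOn p a 0 : ℝ) := by
  have := evalR_le_upperOn p a 0 (a : ℝ) le_rfl (by push_cast; linarith)
  simpa using this

/-- **Soundness of `piecesOK`**: on the span of the list, `P ≤ bound`. -/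
theorem piecesOK_sound (p : List ℚ) (bound : ℚ) :
    ∀ (l : List ℚ) (a : ℚ), piecesOK p bound (a :: l) = true →
      ∀ w : ℝ, (a : ℝ) ≤ w → w ≤ (((a :: l).getLast (List.cons_ne_nil a l) : ℚ) : ℝ) → evalR p w ≤ bound := by
  intro l
  induction l with
  | nil =>
    intro a h w hw1 hw2
    simp only [List.getLast_singleton] at hw2
    have hw : w = a := le_antisymm hw2 hw1
    simp only [piecesOK, decide_eq_true_eq] at h
    rw [hw]; exact (evalR_le_upperOn_zero p a).trans (by exact_mod_cast h)
  | cons b rest ih =>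
    intro a h w hw1 hw2
    simp only [piecesOK, Bool.and_eq_true, decide_eq_true_eq] at h
    obtain ⟨⟨hab, hub⟩, hrest⟩ := h
    rw [List.getLast_cons (List.cons_ne_nil b rest)] at hw2
    by_cases hwb : w ≤ b
    · exact (evalR_le_upperOn p a (b - a) w hw1 (by push_cast; linarith)).trans (by exact_mod_cast hub)
    · push Not at hwb
      exact ih b hrest w hwb.le hw2

/-- **Soundness of the floor certificate**: `P ≤ 0` on `[0, W₁₀]` and `P ≤ 1` on `[W₁₀, 1]`. -/
theorem check_sound (c : FloorCert) (τ : ℚ) (h : c.check τ = true) :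
    (∀ w : ℝ, 0 ≤ w → w ≤ (W10 τ : ℝ) → evalR c.p w ≤ 0) ∧
      (∀ w : ℝ, (W10 τ : ℝ) ≤ w → w ≤ 1 → evalR c.p w ≤ 1) := by
  simp only [check, Bool.and_eq_true, decide_eq_true_eq] at h
  obtain ⟨⟨⟨⟨⟨h0h, h0l⟩, h1h⟩, h1l⟩, hp0⟩, hp1⟩ := h
  constructor
  · intro w hw0 hw1
    match hc : c.cuts0, h0h, h0l, hp0 with
    | a :: l, hh, hl, hp =>
      simp only [List.head?_cons, Option.some.injEq] at hh
      subst hh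
      have := piecesOK_sound c.p 0 l 0 hp w (by simpa using hw0)
        (by rw [List.getLast?_eq_some_getLast (List.cons_ne_nil _ l)] at hl
            simp only [Option.some.injEq] at hl; rw [hl]; exact hw1)
      exact_mod_cast this
  · intro w hw0 hw1
    match hc : c.cuts1, h1h, h1l, hp1 with
    | a :: l, hh, hl, hp =>
      simp only [List.head?_cons, Option.some.injEq] at hh
      subst hh
      have := piecesOK_sound c.p 1 l (W10 τ) hp w hw0
        (by rw [List.getLast?_eq_some_getLast (List.cons_ne_nil _ l)] at hl
            simp only [Option.some.injEq] at hl; rw [hl]; exact_mod_cast hw1)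
      exact_mod_cast this

/-- `v^{2k} = (v²)^k`. -/
theorem vpow_two_mul (τ : ℝ) (k : ℕ) (y : E3) : vpow τ (2 * k) y = (vpow τ 2 y) ^ k := by
  induction k with
  | zero => simp
  | succ k ih => rw [show 2 * (k + 1) = 2 * k + 2 by ring, vpow_add, ih, pow_succ]

/-- The floor 5-polynomial evaluates to `P(W(y))`, `W = v²`. -/
theorem eval_poly (τ : ℝ) (c : FloorCert) (y : E3) : Poly5.eval τ c.poly y = evalR c.p (vpow τ 2 y) := by
  unfold poly evalR Poly5.eval
  rw [List.map_map, ← List.toFinset_range, List.sum_toFinset _ List.nodup_range]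
  congr 1
  refine List.map_congr_left fun k _ => ?_
  simp [Function.comp, Mono5.eval, vpow_two_mul, coeff]

/-- **The certified floor is below the indicator of `B₁₀`**: `P(W(y))·X ≤ 𝟙_{B₁₀}(y)·X` for `X ≥ 0` (`τ > 0`). -/
theorem floor_mul_le {τ : ℚ} (hτ : 0 < τ) (c : FloorCert) (hc : c.check τ = true) (y : E3) {X : ℝ} (hX : 0 ≤ X) :
    Poly5.eval (τ : ℝ) c.poly y * X ≤ (ball (0 : E3) 10).indicator (fun _ => (1 : ℝ)) y * X := by
  obtain ⟨hout, hin⟩ := check_sound c τ hc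
  rw [eval_poly]
  have hk := kbase_pos (τ : ℝ) y
  have hW : vpow (τ : ℝ) 2 y = (kbase (τ : ℝ) y)⁻¹ := vpow_two _ y
  have hW0 : 0 ≤ vpow (τ : ℝ) 2 y := (vpow_pos _ 2 y).le
  have hW1 : vpow (τ : ℝ) 2 y ≤ 1 := vpow_le_one _ 2 y
  have hτR : (0 : ℝ) < τ := by exact_mod_cast hτ
  have hW10 : ((W10 τ : ℚ) : ℝ) = (τ : ℝ) ^ 2 / ((τ : ℝ) ^ 2 + 100) := by unfold W10; push_cast; ring
  have hWeq : vpow (τ : ℝ) 2 y = (τ : ℝ) ^ 2 / ((τ : ℝ) ^ 2 + ‖y‖ ^ 2) := by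
    rw [hW, kbase]; field_simp
  have hτ2 : 0 < (τ : ℝ) ^ 2 := by positivity
  by_cases hy : y ∈ ball (0 : E3) 10
  · rw [indicator_of_mem hy, one_mul]
    have hy' : ‖y‖ < 10 := by simpa [mem_ball, dist_zero_right] using hy
    have hge : ((W10 τ : ℚ) : ℝ) ≤ vpow (τ : ℝ) 2 y := by
      rw [hW10, hWeq]
      exact div_le_div_of_nonneg_left hτ2.le (by positivity) (by nlinarith [norm_nonneg y])
    calc evalR c.p (vpow (τ : ℝ) 2 y) * X ≤ 1 * X := mul_le_mul_of_nonneg_right (hin _ hge hW1) hX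
      _ = X := one_mul X
  · rw [indicator_of_notMem hy, zero_mul]
    have hy' : 10 ≤ ‖y‖ := by simpa [mem_ball, dist_zero_right] using hy
    have hle : vpow (τ : ℝ) 2 y ≤ ((W10 τ : ℚ) : ℝ) := by
      rw [hW10, hWeq]
      exact div_le_div_of_nonneg_left hτ2.le (by positivity) (by nlinarith)
    exact mul_nonpos_of_nonpos_of_nonneg (hout _ hW0 hle) hX

end FloorCert

/-! ## The v2 soundness theorem -/

namespace AlgRowF

/-- Value of the v2 level integrand: `P(W(y))·‖curl U(y)‖²`. -/
theorem eval_levPolyF (r : AlgRowF) (y : E3) :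
    Poly5.eval r.toRow.tauR r.levPolyF y = Poly5.eval r.toRow.tauR r.floor.poly y * ‖curl r.toRow.field y‖ ^ 2 := by
  rw [AlgRowF.levPolyF, Poly5.eval_nmul, r.toRow.curl_field y, AlgRow.norm_sq_evalVec5]

/-- **SOUNDNESS of a v2 row (certified polynomial floor)**: a passing row certifies `ForcedTsaiModulusLE M δ`. -/
theorem sound (r : AlgRowF) (h : r.checkF = true) :
    ForcedTsaiModulusLE (r.M : ℝ) (r.δ : ℝ) := by
  unfold AlgRowF.checkF at h
  rcases hL : r.lev2F with _ | L <;> rcases hR : r.toRow.res2 with _ | R <;> simp only [hL, hR, Bool.and_false,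
    Bool.and_eq_true, decide_eq_true_eq] at h
  · exact absurd h (by simp)
  · exact absurd h (by simp)
  · exact absurd h (by simp)
  obtain ⟨⟨⟨⟨⟨⟨⟨hτ, hr1⟩, hr3⟩, hr5⟩, hM⟩, hδ⟩, hfloor⟩, hlev, hres⟩ := h
  have hτR : 0 < r.toRow.tauR := by unfold AlgRow.tauR AlgRowF.toRow; exact_mod_cast hτ
  have hτ0 : r.toRow.tauR ≠ 0 := hτR.ne'
  have hM' : (0 : ℝ) ≤ r.M := by exact_mod_cast hM
  have hδ' : (0 : ℝ) ≤ r.δ := by exact_mod_cast hδ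
  have hτq : 0 < r.toRow.tau := hτ
  obtain ⟨hintL, hIL⟩ := integral_poly5 hτq r.levPolyF (c := L) hL
  obtain ⟨hintR, hIR⟩ := integral_poly5 hτq r.toRow.resPoly (c := R) hR
  have hτcast : ((r.toRow.tau : ℚ) : ℝ) = r.toRow.tauR := rfl
  rw [hτcast] at hintL hIL hintR hIR
  have hr1' : 0 < r.toRow.r1 := hr1
  have hr3' : 0 < r.toRow.r3 := hr3
  have hr5' : 0 < r.toRow.r5 := hr5
  refine ⟨r.toRow.field, r.toRow.contDiff_field, r.toRow.isDivFree_field, ?_, ?_, ?_⟩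
  · -- LEVEL via the certified floor
    unfold lerayLevel
    refine (Real.le_sqrt hM' (integral_nonneg fun y => sq_nonneg _)).mpr ?_
    have hind : IntegrableOn (fun y => ‖curl r.toRow.field y‖ ^ 2) (ball (0 : E3) 10) := by
      have hc : Continuous fun y => ‖curl r.toRow.field y‖ ^ 2 := by
        have : (fun y => ‖curl r.toRow.field y‖ ^ 2) = fun y => ‖evalVec5 r.toRow.tauR r.toRow.om y‖ ^ 2 :=
          funext fun y => by rw [r.toRow.curl_field y]
        rw [this]; exact (continuous_evalVec5 _ _).norm.pow 2
      exact (hc.continuousOn.integrableOn_compact (isCompact_closedBall (0 : E3) 10)).mono_set ball_subset_closedBall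
    have hmono : ∫ y, Poly5.eval r.toRow.tauR r.levPolyF y ≤ ∫ y in ball (0 : E3) 10, ‖curl r.toRow.field y‖ ^ 2 := by
      rw [← integral_indicator measurableSet_ball]
      refine integral_mono hintL (hind.integrable_indicator measurableSet_ball) fun y => ?_
      beta_reduce
      rw [r.eval_levPolyF y]
      have key := FloorCert.floor_mul_le hτ r.floor hfloor y (sq_nonneg ‖curl r.toRow.field y‖)
      refine key.trans (le_of_eq ?_)
      by_cases hy : y ∈ ball (0 : E3) 10
      · rw [indicator_of_mem hy, indicator_of_mem hy, one_mul]
      · rw [indicator_of_notMem hy, indicator_of_notMem hy, zero_mul]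
    have hlev' : (r.M : ℝ) ^ 2 ≤ (encLo L : ℝ) := by
      have := hlev; rw [← sq] at this; exact_mod_cast this
    calc (r.M : ℝ) ^ 2 ≤ (encLo L : ℝ) := hlev'
      _ ≤ (L.1 : ℝ) * π + (L.2 : ℝ) * π ^ 2 := encLo_le L
      _ = ∫ y, Poly5.eval r.toRow.tauR r.levPolyF y := hIL.symm
      _ ≤ ∫ y in ball (0 : E3) 10, ‖curl r.toRow.field y‖ ^ 2 := hmono
  · -- INTEGRABILITY (as in v1)
    refine hintR.mono' ?_ (Filter.Eventually.of_forall fun y => ?_)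
    · have hc : Continuous fun y => (1 + ‖y‖) ^ 5 * ‖lerayVorticityResidual r.toRow.field y‖ ^ 2 := by
        have : (fun y => (1 + ‖y‖) ^ 5 * ‖lerayVorticityResidual r.toRow.field y‖ ^ 2) = fun y =>
            (1 + ‖y‖) ^ 5 * ‖evalVec5 r.toRow.tauR r.toRow.g y‖ ^ 2 := by
          funext y; rw [r.toRow.vorticityResidual_field y]
        rw [this]
        exact ((continuous_const.add continuous_norm).pow 5).mul ((continuous_evalVec5 _ _).norm.pow 2)
      exact hc.aestronglyMeasurable
    · rw [Real.norm_eq_abs, abs_of_nonneg (by positivity), r.toRow.eval_resPoly hτ0 y]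
      exact mul_le_mul_of_nonneg_right (pow_five_le_majorPoly r.toRow.tauR hr1' hr3' hr5' y) (sq_nonneg _)
  · -- RESIDUAL (as in v1)
    unfold lerayResidualNorm
    rw [show (r.δ : ℝ) = Real.sqrt ((r.δ : ℝ) ^ 2) by rw [Real.sqrt_sq hδ']]
    refine Real.sqrt_le_sqrt ?_
    have hstep : ∫ y, (1 + ‖y‖) ^ 5 * ‖lerayVorticityResidual r.toRow.field y‖ ^ 2 ≤
        ∫ y, Poly5.eval r.toRow.tauR r.toRow.resPoly y := by
      refine integral_mono_of_nonneg (Filter.Eventually.of_forall fun y => by positivity) hintR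
        (Filter.Eventually.of_forall fun y => ?_)
      beta_reduce
      rw [r.toRow.eval_resPoly hτ0 y]
      exact mul_le_mul_of_nonneg_right (pow_five_le_majorPoly r.toRow.tauR hr1' hr3' hr5' y) (sq_nonneg _)
    have hres' : (encHi R : ℝ) ≤ (r.δ : ℝ) ^ 2 := by
      have := hres; rw [← sq] at this; exact_mod_cast this
    calc ∫ y, (1 + ‖y‖) ^ 5 * ‖lerayVorticityResidual r.toRow.field y‖ ^ 2
        ≤ ∫ y, Poly5.eval r.toRow.tauR r.toRow.resPoly y := hstep
      _ = (R.1 : ℝ) * π + (R.2 : ℝ) * π ^ 2 := hIR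
      _ ≤ (encHi R : ℝ) := le_encHi R
      _ ≤ (r.δ : ℝ) ^ 2 := hres'

end AlgRowF

end Summit.NavierStokesRegularity.NavierStokesRegularity.Cruxes.ScarEnvelopeTypeI.ForcedTsai

end
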